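import Summits.BirchSwinnertonDyer.BirchSwinnertonDyer.Theorems.ErratumRoadFiveShimuraKolyvaginOrderBoundInertLocalAll
import Summits.BirchSwinnertonDyer.BirchSwinnertonDyer.Theorems.AdditiveBranchIMCGenusGrossZagierFourthCurve
import Summits.BirchSwinnertonDyer.Rank1Residual.Additive.CyclotomicPrimeMultiplicativeReduction
import Literature.NumberTheory.EllipticCurves.NeronComponentIndexSplitProofs
import Literature.NumberTheory.EllipticCurves.PAdicBSDSplitMultiplicativeProofs
import Literature.NumberTheory.EllipticCurves.IrreducibleModPQuadraticTwistProofs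
import Literature.NumberTheory.QuadraticFields.HeegnerCondition
import HarnessLib

/-!
# Route `AdditiveBranchIMC`, cruxes `GordTwoRankZeroOffCaseOne` (stmt-BirchSwinnertonDyer-19357) ∕ `MultLower` (19359),
# lines `three_field_road` ∕ `tame_roads_mult`, stub `stub_genusPlacesNonsplit[M]` (L3, skeleton v12):
# THE SUB-ROW'S PLACE ANALYSIS — a multiplicative place of `Wd ⊗ K″` with `p ∣ ord_v Δ_min` is NOT split

Cell `bsd-addord` (run/shared/lean/pub/bsd-addord/), seat `cruxlead-19357-g2` (lead prover), HELPER
(`--supports stmt-BirchSwinnertonDyer-19357 --as helper`). Skeleton v12 (`Lines/three_field_road.lean` 234159696c73,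
`Lines/tame_roads_mult.lean` 4ae50f78ee1b) proves the G5 residual `stub_genusLocalNonsplit[M]` by McCallum's non-split
mechanism (`Theorems/AdditiveBranchIMCGenusKolyvaginLocalNonsplitMechanism.lean`, p678098) modulo two reduction-type
statements; this file proves the SECOND (L3) with the clauses of the line's `RamifiedKolyvaginField[M]` unbundled:

* §1 `absNorm_eq_of_ncard_eq_two_or_dvd_discr` — in a quadratic field a prime `v ∋ ℓ` has `N(v) = ℓ` as soon as `ℓ`
  is not inert: two primes over `ℓ`, or `ℓ ∣ d_K` (fundamental identity `Σ e f = 2`, Mathlib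
  `Ideal.sum_ramification_inertia_eq_finrank`; Dedekind's `ℓ ∣ d_K ⟹ ℓ` ramified, Mathlib
  `NumberField.not_dvd_discr_iff_isUnramifiedIn`); `exists_two_le_ramificationIdx_of_dvd_discr`.
* §2 `exists_variableChange_baseChange_of_quadraticTwist_discr` — if `A = C • Wd^{(d_K)}` over `ℚ` then
  `A ⊗ K = C′ • (Wd ⊗ K)` over the quadratic field `K` (`√d_K ∈ K`, tree `Quadratic.exists_sq_eq_discr`; a twist by a
  square is an isomorphism, tree `exists_variableChange_quadraticTwist_mul_sq` ∕ `_one`).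
* §3 **`not_hasSplitMultiplicativeReductionAt_baseChange_of_dvd_ordMinimalDiscriminant`** — `K` imaginary quadratic;
  `Wd, A` globally minimal over `ℚ` with `A = C • Wd^{(d_K)}`; every prime of `N_{Wd}` prime to `d_K` splits in `K`
  (clause (3) of `RamifiedKolyvaginField`); at every prime `ℓ ∣ (N_{Wd}, d_K)` the partner `A` is good, or
  multiplicative and NOT split (clause (4), with `ℓ = p` covered by `GoodOrd A p` on the (G-ord) row and by clause (4)
  itself on the (M) row); `p ∤ ∏_ℓ c_ℓ(Wd)`. THEN a place `v` of `K` at which `Wd ⊗ K` is multiplicative with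
  `p ∣ ord_v Δ_min(Wd ⊗ K)` is not split multiplicative. Proof: `ℓ` the prime under `v`; `Wd` is bad at `ℓ`
  (good reduction ascends); (a) `ℓ ∤ d_K`: `ℓ` splits, `e = f = 1`, so `ord_v = ord_ℓ Δ_min(Wd)` and `Wd` is
  multiplicative at `ℓ` (x11b3 ∕ bsd-stepL `kodairaSymbolAt_and_ordMinimalDiscriminant_baseChange_eq_of_split`); were
  `Wd` split at `ℓ`, `c_ℓ(Wd) = ord_ℓ Δ_min` (Tate, tree `localTamagawaNumber_eq_ordMinimalDiscriminant_of_hasSplitMultiplicativeReductionAt`)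
  would be divisible by `p` — excluded; so `Wd` is non-split at `ℓ` and stays non-split at the degree-one place `v`
  (x11b3's `Additive.not_hasSplitMultiplicativeReductionAt_baseChange_of_not_split_prime`); (b) `ℓ ∣ d_K`: `N(v) = ℓ`
  (§1); if `A` is good at `ℓ` then `A ⊗ K ≅ Wd ⊗ K` is good at `v` — not multiplicative; if `A` is non-split
  multiplicative at `ℓ` it stays non-split at `v`, and so does the `K`-isomorphic `Wd ⊗ K` (tree
  `hasSplitMultiplicativeReductionAt_smul_iff_holds`).

THEOREMS ONLY; no `sorry`; nothing about BSD is proved here; the cruxes stay OPEN (L2 `stub_nonsplitFrobeniusSign[M]`,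
the by-design residual, the cite-only printed facts and the sibling line's `tameJointLower` remain).

References: [cite: SilvermanAEC2009, VII.5 Prop. 5.1 (b), Prop. 5.4 (a), Thm. VII.6.1, X.5 Cor. 5.4]
[cite: SilvermanATAEC1994, Cor. IV.9.2 (d)] [cite: NeukirchANT1999, Ch. I (8.2), Ch. III (2.12)]
[cite: CasselsFrohlich1967, Ch. I §10 Prop. 1].

presearch: «base change of a non-split multiplicative prime to a degree-one place stays non-split; c_ℓ = ord Δ at a split
node» → [corpus: SilvermanAEC2009 VII.5.1(b), VII.6.1; SilvermanATAEC1994 IV.9.2(d)] textbook; tree: x11b3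
`not_hasSplitMultiplicativeReductionAt_baseChange_of_not_split_prime`, `localTamagawaNumber_eq_ordMinimalDiscriminant_of_…`
(`lean search`); galaxy "non-split multiplicative|Tamagawa number" → textbook pages only. Bookkeeping, no new mathematics.
-/

noncomputable section

open scoped Classical

set_option linter.dupNamespace false

namespace Summit.BirchSwinnertonDyer.BirchSwinnertonDyer.Theorems.GenusKolyvagin

open WeierstrassCurve NumberField IsDedekindDomain Field
  Literature.NumberTheory.EllipticCurves Literature.NumberTheory.NumberFields
  Summit.BirchSwinnertonDyer.Rank1Residual.Additive

variable {K : Type} [Field K] [NumberField K]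

/-! ### §1 Degree-one places of a quadratic field -/

/-- **`ℓ ∣ d_K` gives a ramified prime over `ℓ`** (Dedekind's discriminant theorem, Mathlib
`NumberField.not_dvd_discr_iff_isUnramifiedIn`): some prime `u ∋ ℓ` of `𝓞 K` has `e(u|ℓ) ≥ 2`.
[cite: NeukirchANT1999, Ch. III (2.12)] -/
theorem exists_two_le_ramificationIdx_of_dvd_discr {ℓ : ℕ} (hℓ : ℓ.Prime) (hdvd : (ℓ : ℤ) ∣ discr K) :
    ∃ u : HeightOneSpectrum (𝓞 K), ((ℓ : ℕ) : 𝓞 K) ∈ u.asIdeal ∧ 2 ≤ u.asIdeal.ramificationIdx ℤ := by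
  have hp' : Prime (ℓ : ℤ) := Nat.prime_iff_prime_int.mp hℓ
  by_contra H
  push Not at H
  have hunr : Algebra.IsUnramifiedIn (𝓞 K) (Ideal.span {(ℓ : ℤ)}) := by
    rw [Algebra.isUnramifiedIn_iff_forall_ramificationIdx_eq_one]
    intro P hP hPover
    have hpb : Ideal.span {(ℓ : ℤ)} ≠ ⊥ := by simp [hℓ.ne_zero]
    have hPne : P ≠ ⊥ := Ideal.ne_bot_of_liesOver_of_ne_bot hpb P
    let u : HeightOneSpectrum (𝓞 K) := ⟨P, hP, hPne⟩
    have hmem : ((ℓ : ℕ) : 𝓞 K) ∈ u.asIdeal := by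
      have h : ((ℓ : ℕ) : ℤ) ∈ P.under ℤ := hPover.over ▸ Ideal.mem_span_singleton_self _
      rw [Ideal.under_def, Ideal.mem_comap, map_natCast] at h
      exact h
    have h1 : P.ramificationIdx ℤ < 2 := H u hmem
    have h2 : 1 ≤ P.ramificationIdx ℤ := Ideal.ramificationIdx_pos P ℤ
    omega
  exact (NumberField.not_dvd_discr_iff_isUnramifiedIn K (𝓞 K) hp').mpr hunr hdvd

/-- **In a quadratic field a prime `v ∋ ℓ` has absolute norm `ℓ` as soon as `ℓ` is not inert**: if there are two
primes over `ℓ`, or `ℓ ∣ d_K`, then `f(v|ℓ) = 1` by the fundamental identity `Σ_{w ∣ ℓ} e(w)f(w) = [K:ℚ] = 2`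
(Mathlib `Ideal.sum_ramification_inertia_eq_finrank`), hence `N(v) = ℓ^{f} = ℓ`.
[cite: CasselsFrohlich1967, Ch. I §10 Prop. 1] [cite: NeukirchANT1999, Ch. I (8.2)] -/
theorem absNorm_eq_of_ncard_eq_two_or_dvd_discr (hK2 : Module.finrank ℚ K = 2) {ℓ : ℕ} (hℓ : ℓ.Prime)
    (v : HeightOneSpectrum (𝓞 K)) (hℓv : ((ℓ : ℕ) : 𝓞 K) ∈ v.asIdeal)
    (h : ((Ideal.span {(ℓ : ℤ)}).primesOver (𝓞 K)).ncard = 2 ∨ (ℓ : ℤ) ∣ discr K) :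
    Ideal.absNorm v.asIdeal = ℓ := by
  classical
  set p : Ideal ℤ := Ideal.span {(ℓ : ℤ)} with hpdef
  have hpZ : Prime (ℓ : ℤ) := Nat.prime_iff_prime_int.mp hℓ
  haveI hpprime : p.IsPrime := (Ideal.span_singleton_prime hpZ.ne_zero).mpr hpZ
  haveI hpmax : p.IsMaximal := hpprime.isMaximal (by simp [hpdef, hℓ.ne_zero])
  have hmemover : ∀ w : HeightOneSpectrum (𝓞 K), ((ℓ : ℕ) : 𝓞 K) ∈ w.asIdeal →
      w.asIdeal ∈ p.primesOver (𝓞 K) := fun w hw ↦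
    ⟨w.isPrime, Ideal.liesOver_span_of_natCast_mem' hℓ hw⟩
  have hofmem : ∀ P ∈ p.primesOver (𝓞 K), ∃ w : HeightOneSpectrum (𝓞 K),
      ((ℓ : ℕ) : 𝓞 K) ∈ w.asIdeal ∧ w.asIdeal = P := by
    intro P hP
    haveI : P.IsPrime := hP.1
    haveI : P.LiesOver p := hP.2
    have hmem : ((ℓ : ℕ) : 𝓞 K) ∈ P := by
      have h1 : ((ℓ : ℕ) : ℤ) ∈ P.under ℤ := by
        rw [← Ideal.LiesOver.over (P := P) (p := p)]; exact Ideal.mem_span_singleton_self _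
      rw [Ideal.under_def, Ideal.mem_comap, map_natCast] at h1
      exact h1
    have hPne : P ≠ ⊥ := fun hb ↦ by
      rw [hb, Ideal.mem_bot, Nat.cast_eq_zero] at hmem
      exact hℓ.ne_zero hmem
    exact ⟨⟨P, hP.1, hPne⟩, hmem, rfl⟩
  -- the fundamental identity `Σ e f = 2`
  have hsum := Ideal.sum_ramification_inertia_eq_finrank p (𝓞 K)
  rw [NumberField.RingOfIntegers.rank, hK2] at hsum
  -- two distinct terms, or one term with `e ≥ 2`, force `f(v) = 1`
  have hfv : v.asIdeal.inertiaDeg ℤ = 1 := by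
    have hv : (⟨v.asIdeal, hmemover v hℓv⟩ : p.primesOver (𝓞 K)) ∈ (Finset.univ : Finset _) :=
      Finset.mem_univ _
    have hev : 1 ≤ v.asIdeal.ramificationIdx ℤ := Ideal.ramificationIdx_pos v.asIdeal ℤ
    have hfv1 : 1 ≤ v.asIdeal.inertiaDeg ℤ := Ideal.inertiaDeg_pos v.asIdeal ℤ
    -- a second prime `u ≠ v` over `ℓ` with `e(u) f(u) ≥ 1`, or `u` with `e(u) ≥ 2`
    have key : ∃ u : HeightOneSpectrum (𝓞 K), ((ℓ : ℕ) : 𝓞 K) ∈ u.asIdeal ∧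
        (u ≠ v ∨ 2 ≤ u.asIdeal.ramificationIdx ℤ) := by
      rcases h with h2 | hd
      · obtain ⟨P, P', hne, hPP'⟩ := Set.ncard_eq_two.mp h2
        have hP : P ∈ p.primesOver (𝓞 K) := hPP' ▸ Set.mem_insert P {P'}
        have hP' : P' ∈ p.primesOver (𝓞 K) := hPP' ▸ Set.mem_insert_of_mem P (Set.mem_singleton P')
        obtain ⟨w, hw, rfl⟩ := hofmem P hP
        obtain ⟨w', hw', rfl⟩ := hofmem P' hP'
        by_cases hwv : w = v
        · exact ⟨w', hw', Or.inl fun h' ↦ hne (by rw [hwv, h'])⟩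
        · exact ⟨w, hw, Or.inl hwv⟩
      · obtain ⟨u, hu, hu2⟩ := exists_two_le_ramificationIdx_of_dvd_discr (K := K) hℓ hd
        exact ⟨u, hu, Or.inr hu2⟩
    obtain ⟨u, hu, hu'⟩ := key
    by_cases huv : u = v
    · subst huv
      rcases hu' with h' | hu2
      · exact absurd rfl h'
      have h2 := Finset.single_le_sum (fun q _ ↦ Nat.zero_le _) hv
        (f := fun q : p.primesOver (𝓞 K) ↦ (q.1).ramificationIdx ℤ * (q.1).inertiaDeg ℤ)
      rw [hsum] at h2
      change u.asIdeal.ramificationIdx ℤ * u.asIdeal.inertiaDeg ℤ ≤ 2 at h2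
      nlinarith
    · have hne : (⟨v.asIdeal, hmemover v hℓv⟩ : p.primesOver (𝓞 K)) ≠ ⟨u.asIdeal, hmemover u hu⟩ :=
        fun heq ↦ huv (HeightOneSpectrum.ext (congrArg Subtype.val heq).symm)
      have h2 := Finset.add_le_sum
        (f := fun q : p.primesOver (𝓞 K) ↦ (q.1).ramificationIdx ℤ * (q.1).inertiaDeg ℤ)
        (fun q _ ↦ Nat.zero_le _) hv (Finset.mem_univ _) hne
      rw [hsum] at h2
      have heu : 1 ≤ u.asIdeal.ramificationIdx ℤ := Ideal.ramificationIdx_pos u.asIdeal ℤ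
      have hfu : 1 ≤ u.asIdeal.inertiaDeg ℤ := Ideal.inertiaDeg_pos u.asIdeal ℤ
      change v.asIdeal.ramificationIdx ℤ * v.asIdeal.inertiaDeg ℤ +
        u.asIdeal.ramificationIdx ℤ * u.asIdeal.inertiaDeg ℤ ≤ 2 at h2
      nlinarith
  haveI := Ideal.liesOver_span_of_natCast_mem' hℓ hℓv
  haveI : v.asIdeal.IsMaximal := v.isPrime.isMaximal v.ne_bot
  rw [Ideal.absNorm_eq_pow_inertiaDeg' v.asIdeal hℓ, Ideal.inertiaDeg'_eq_inertiaDeg, hfv, pow_one]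

/-! ### §2 Over `K = ℚ(√d_K)` the twist by `d_K` is an isomorphism -/

/-- **`A = C • Wd^{(d_K)}` over `ℚ` gives `A ⊗ K = C′ • (Wd ⊗ K)` over the quadratic field `K`**: `d_K = δ²` with
`δ ∈ 𝓞 K` (tree `Quadratic.exists_sq_eq_discr`), and a twist by a non-zero square is a change of variables (tree
`exists_variableChange_quadraticTwist_mul_sq`, `exists_variableChange_quadraticTwist_one`; base change commutes with
twists, `baseChange_quadraticTwist`, and with changes of variables, Mathlib `map_variableChange`).
[cite: SilvermanAEC2009, X.5 Cor. 5.4] -/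
theorem exists_variableChange_baseChange_of_quadraticTwist_discr (hK2 : Module.finrank ℚ K = 2)
    (Wd A : WeierstrassCurve ℚ)
    (htwA : ∃ C : VariableChange ℚ, C • Wd.quadraticTwist (NumberField.discr K : ℚ) = A) :
    ∃ C' : VariableChange K, C' • Wd.baseChange K = A.baseChange K := by
  obtain ⟨C, hC⟩ := htwA
  obtain ⟨t, m, δ, -, hδ⟩ := Literature.NumberTheory.QuadraticFields.Quadratic.exists_sq_eq_discr (K := K) hK2
  have h1 : (δ : K) ^ 2 = (NumberField.discr K : K) := by
    have h := congrArg (algebraMap (𝓞 K) K) hδ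
    rwa [map_pow, map_intCast] at h
  have hθ0 : (δ : K) ≠ 0 := by
    intro h0
    rw [h0, zero_pow two_ne_zero] at h1
    exact NumberField.discr_ne_zero K (by exact_mod_cast h1.symm)
  have hθ2 : algebraMap ℚ K (NumberField.discr K : ℚ) = 1 * (δ : K) ^ 2 := by
    rw [one_mul, map_intCast, h1]
  obtain ⟨C₀, hC₀⟩ := (Wd.baseChange K).exists_variableChange_quadraticTwist_one
  obtain ⟨C₁, hC₁⟩ := (Wd.baseChange K).exists_variableChange_quadraticTwist_mul_sq 1 (δ : K) hθ0
  refine ⟨C.map (algebraMap ℚ K) * C₁ * C₀, ?_⟩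
  rw [mul_smul, mul_smul, hC₀, hC₁, ← hθ2, ← baseChange_quadraticTwist, baseChange, baseChange,
    map_variableChange, hC]

/-! ### §3 The place analysis -/

/-- **On the sub-row, a multiplicative place of `Wd ⊗ K″` with `p ∣ ord_v Δ_min` is not split.** See the module
docstring for the statement in words and the proof. The clauses of the line's `RamifiedKolyvaginField[M]` enter
unbundled: `h3` (primes of `N_{Wd}` prime to `d_K` split in `K`) and `h4` (at the primes of `N_{Wd}` dividing `d_K`
the partner `A` is good, or multiplicative and not split — on the (G-ord) row the prime `p` itself is served by
`GoodOrd A p`). [cite: SilvermanAEC2009, VII.5 Prop. 5.1 (b), Prop. 5.4 (a), Thm. VII.6.1, X.5 Cor. 5.4]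
[cite: SilvermanATAEC1994, Cor. IV.9.2 (d)] -/
theorem not_hasSplitMultiplicativeReductionAt_baseChange_of_dvd_ordMinimalDiscriminant
    (hK : IsImaginaryQuadratic K)
    (Wd : WeierstrassCurve ℚ) [Wd.IsElliptic] [Wd.IsGloballyMinimal]
    (A : WeierstrassCurve ℚ) [A.IsElliptic] [A.IsGloballyMinimal] {p : ℕ}
    (h3 : ∀ ℓ : ℕ, ℓ.Prime → ℓ ∣ Wd.conductorNorm ℤ → ¬ (ℓ : ℤ) ∣ NumberField.discr K →
      SatisfiesHeegnerHypothesis ℓ K)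
    (h4 : ∀ ℓ : ℕ, (hℓ : ℓ.Prime) → ℓ ∣ Wd.conductorNorm ℤ → (ℓ : ℤ) ∣ NumberField.discr K →
      (haveI : Fact ℓ.Prime := ⟨hℓ⟩;
        A.HasGoodReductionAtPrime ℓ ∨
          (A.HasMultiplicativeReductionAtPrime ℓ ∧ ¬ A.HasSplitMultiplicativeReductionAtPrime ℓ)))
    (htwA : ∃ C : VariableChange ℚ, C • Wd.quadraticTwist (NumberField.discr K : ℚ) = A)
    (htam : ¬ p ∣ Wd.tamagawaProduct)
    (v : HeightOneSpectrum (𝓞 K)) (hmult : (Wd.baseChange K).HasMultiplicativeReductionAt v)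
    (hord : p ∣ (Wd.baseChange K).ordMinimalDiscriminant v) :
    ¬ (Wd.baseChange K).HasSplitMultiplicativeReductionAt v := by
  haveI : (Wd.baseChange K).IsElliptic := inferInstanceAs (Wd.map (algebraMap ℚ K)).IsElliptic
  haveI : (A.baseChange K).IsElliptic := inferInstanceAs (A.map (algebraMap ℚ K)).IsElliptic
  intro hsplit
  -- the rational prime `ℓ` under `v`
  set v₀ : HeightOneSpectrum (𝓞 ℚ) := v.under (𝓞 ℚ) with hv₀def
  haveI hlo : v.asIdeal.LiesOver v₀.asIdeal := ⟨rfl⟩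
  set ℓ : ℕ := (Rat.HeightOneSpectrum.primesEquiv v₀ : ℕ) with hℓdef
  have hℓP : ℓ.Prime := (Rat.HeightOneSpectrum.primesEquiv v₀).2
  haveI : Fact ℓ.Prime := ⟨hℓP⟩
  have hℓv₀ : (ℓ : 𝓞 ℚ) ∈ v₀.asIdeal :=
    (natCast_mem_asIdeal_iff_eq_primesEquiv_symm v₀ hℓP).mpr (Equiv.symm_apply_apply _ v₀).symm
  have hℓv : ((ℓ : ℕ) : 𝓞 K) ∈ v.asIdeal := by
    have h := hℓv₀
    rw [hv₀def] at h
    change (ℓ : 𝓞 ℚ) ∈ Ideal.comap (algebraMap (𝓞 ℚ) (𝓞 K)) v.asIdeal at h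
    rw [Ideal.mem_comap, map_natCast] at h
    exact h
  -- `Wd` is bad at `ℓ`
  have hbad₀ : ¬ Wd.HasGoodReductionAt v₀ := fun h ↦
    hmult.not_hasGoodReductionAt (hasGoodReductionAt_baseChange_of_hasGoodReductionAt_rat Wd v₀ v h)
  have hℓN : ℓ ∣ Wd.conductorNorm ℤ := (Wd.dvd_conductorNorm_iff v₀).mpr hbad₀
  -- the `K`-isomorphism `A ⊗ K = C′ • (Wd ⊗ K)`
  obtain ⟨C', hC'⟩ := exists_variableChange_baseChange_of_quadraticTwist_discr hK.1 Wd A htwA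
  by_cases hd : (ℓ : ℤ) ∣ NumberField.discr K
  · -- (b) `ℓ ∣ d_K`: `N(v) = ℓ`; the partner `A` decides
    have hN : Ideal.absNorm v.asIdeal = ℓ :=
      absNorm_eq_of_ncard_eq_two_or_dvd_discr hK.1 hℓP v hℓv (Or.inr hd)
    rcases h4 ℓ hℓP hℓN hd with hgood | ⟨hmA, hnsA⟩
    · -- `A` good at `ℓ` ⇒ `A ⊗ K`, hence `Wd ⊗ K`, good at `v`
      have hgoodA₀ : A.HasGoodReductionAt v₀ := by
        by_contra hb
        exact (GenusGrossZagier.not_dvd_conductorNorm_iff_hasGoodReductionAtPrime A ℓ).mpr hgood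
          ((A.dvd_conductorNorm_iff v₀).mpr hb)
      have hgoodA : (A.baseChange K).HasGoodReductionAt v :=
        hasGoodReductionAt_baseChange_of_hasGoodReductionAt_rat A v₀ v hgoodA₀
      rw [← hC', WeierstrassCurve.hasGoodReductionAt_smul_iff_holds v (Wd.baseChange K) C'] at hgoodA
      exact hmult.not_hasGoodReductionAt hgoodA
    · -- `A` non-split multiplicative at `ℓ` stays non-split at the degree-one place `v`
      have hnsAK : ¬ (A.baseChange K).HasSplitMultiplicativeReductionAt v :=
        not_hasSplitMultiplicativeReductionAt_baseChange_of_not_split_prime A ℓ v hℓv hN hmA hnsA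
      rw [← hC', WeierstrassCurve.hasSplitMultiplicativeReductionAt_smul_iff_holds v (Wd.baseChange K) C']
        at hnsAK
      exact hnsAK hsplit
  · -- (a) `ℓ ∤ d_K`: `ℓ` splits in `K`
    have hH : SatisfiesHeegnerHypothesis ℓ K := h3 ℓ hℓP hℓN hd
    have h2 : ((Ideal.span {(ℓ : ℤ)}).primesOver (𝓞 K)).ncard = 2 := hH ℓ hℓP (dvd_refl ℓ)
    have hN : Ideal.absNorm v.asIdeal = ℓ :=
      absNorm_eq_of_ncard_eq_two_or_dvd_discr hK.1 hℓP v hℓv (Or.inl h2)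
    -- Tate's algorithm of `Wd ⊗ K` at `v` is that of `Wd` at `ℓ`
    have hsp : ∀ q : ℕ, q.Prime → q ∣ Wd.conductorNorm ℤ → q ∉ (NumberField.discr K).natAbs.primeFactors →
        ((Ideal.span {(q : ℤ)}).primesOver (𝓞 K)).ncard = 2 := by
      intro q hq hqN hqS
      have hqd : ¬ (q : ℤ) ∣ NumberField.discr K := fun hdq ↦ hqS
        (Nat.mem_primeFactors.mpr ⟨hq, Int.natCast_dvd.mp hdq, (Int.natAbs_ne_zero.mpr
          (NumberField.discr_ne_zero K))⟩)
      exact h3 q hq hqN hqd q hq (dvd_refl q)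
    have hℓS : (Rat.HeightOneSpectrum.primesEquiv (v.under (𝓞 ℚ)) : ℕ) ∉
        (NumberField.discr K).natAbs.primeFactors := fun hmem ↦
      hd (Int.natCast_dvd.mpr (Nat.mem_primeFactors.mp hmem).2.1)
    obtain ⟨hks, hordeq, -⟩ := kodairaSymbolAt_and_ordMinimalDiscriminant_baseChange_eq_of_split hK Wd rfl
      hsp v hmult.not_hasGoodReductionAt hℓS
    -- `Wd` is multiplicative at `ℓ`
    have hmv : Wd.HasMultiplicativeReductionAt v₀ := by
      rcases hasGoodReductionAt_or_hasMultiplicativeReductionAt_or_hasAdditiveReductionAt v₀ Wd with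
        hg | hm | ha
      · exact absurd hg hbad₀
      · exact hm
      · exfalso
        have hKs : ((Wd.baseChange K).kodairaSymbolAt v).IsAdditive := by
          rw [hks]; exact (WeierstrassCurve.isAdditive_kodairaSymbolAt_iff_holds _ Wd).mpr ha
        exact ((WeierstrassCurve.isAdditive_kodairaSymbolAt_iff_holds v (Wd.baseChange K)).mp
          hKs).not_hasMultiplicativeReductionAt hmult
    have hmℓ : Wd.HasMultiplicativeReductionAtPrime ℓ :=
      (Wd.hasMultiplicativeReductionAtPrime_iff_hasMultiplicativeReductionAt_ringOfIntegers v₀).mpr hmv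
    by_cases hsℓ : Wd.HasSplitMultiplicativeReductionAtPrime ℓ
    · -- split at `ℓ`: `p ∣ ord_v = ord_ℓ Δ_min = c_ℓ(Wd) ∣ ∏ c`, excluded
      have hsv₀ : Wd.HasSplitMultiplicativeReductionAt v₀ :=
        (Wd.hasSplitMultiplicativeReductionAtPrime_iff_hasSplitMultiplicativeReductionAt v₀).mp hsℓ
      have hc := localTamagawaNumber_eq_ordMinimalDiscriminant_of_hasSplitMultiplicativeReductionAt v₀ Wd hsv₀
      have hord₀ : Wd.ordMinimalDiscriminant v₀ = padicValInt ℓ Wd.minimalDiscriminantInt :=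
        LocalTorsionMult.ordMinimalDiscriminant_eq_padicValInt Wd v₀ rfl
      have hdvd : (Wd.baseChange (v₀.adicCompletion ℚ)).localTamagawaNumber (v₀.adicCompletionIntegers ℚ) ∣
          Wd.tamagawaProduct :=
        finprod_mem_dvd v₀ Wd.mulSupport_localTamagawaNumber_finite_holds
      refine htam (dvd_trans ?_ hdvd)
      rw [hc, hord₀, ← hordeq]
      exact hord
    · -- non-split at `ℓ` stays non-split at the degree-one place `v`
      exact not_hasSplitMultiplicativeReductionAt_baseChange_of_not_split_prime Wd ℓ v hℓv hN hmℓ hsℓ hsplit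

end Summit.BirchSwinnertonDyer.BirchSwinnertonDyer.Theorems.GenusKolyvagin

end
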